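import Mathlib
import Summits.ResolutionOfSingularities.ResolutionOfSingularities.Theorems.WeightedInvariantLocalWeightedDropTOT2NearCurveRestrict
import Summits.ResolutionOfSingularities.ResolutionOfSingularities.Theorems.WeightedInvariantLocalWeightedDropRestrictedChartTransport

/-!
# `WeightedInvariant.LocalWeightedDrop`, TOT₂ line: THE KERNEL LEMMA AT A WEIGHTED CHART — an invariance vector of the successor's form that
# vanishes on the exceptional letter and on the parameter letters lifts to an invariance vector of `in_o f` (and dies there if `in_o f` has none)

Crux item stmt-ResolutionOfSingularities-8899 `LocalWeightedDrop` (route `ResolutionOfSingularities/WeightedInvariant`), ENGINE skeleton v32/v33; S-E2-SURF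
design memo `L/res-L1-w43-stub-4/g5/S-E2-SURF.md` §9.  [OURS · L1 W4.3 · chain w43 · seat res-L1-w43-stub-4 gen 5; def-free; weighted twin of
res-L1-w43-stub-3's `TOT2Near.insertNth_inv_of_inv_cons_zero` (…TOT2NearDir §3) for vectors vanishing on the parameter letters, assuming reduction
vectors in `Dir(in_o f)` (a vector `t` live at `i₀` and the parameter unit vectors); nothing here is a statement of any manuscript; AI-produced,
gate-checked, weaker than expert review.]

* **`insertNth_inv_of_inv_cons_zero_w`** — weights `w ∈ {0,1}^{n+1}` with ONE parameter letter `l₀` (`w_l = 0 ↔ l = l₀`; a curve move), chart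
  convention, `o ≤ weightedOrder_w f`, `f(chart) = s^o G`, live slot `i₀ ≠ l₀`; suppose `Dir(in_o f)` contains a vector `t` with `t_{i₀} ≠ 0`
  and the unit vector `e_{l₀}`.  Then an invariance vector `(0, z)` of `in_o G′` with `z` vanishing at the slot of `l₀` gives the
  invariance vector `z ↑ i₀` of `in_o f`.
-/

set_option linter.dupNamespace false -- mandated namespace of this single-conjunct summit

noncomputable section

namespace Summit.ResolutionOfSingularities.ResolutionOfSingularities.Theorems

namespace TOT2Near

open MvPowerSeries Literature.AlgebraicGeometry.Resolution

variable {k : Type} [Field k]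

/-- **THE KERNEL LEMMA AT A WEIGHTED CHART WITH ONE PARAMETER LETTER `l₀`** (see the module docstring): reduction vectors `t` (live at `i₀`)
and `e_{l₀}` in `Dir(in_o f)`; an invariance vector `(0, z)` of `in_o G′` with `z` vanishing at the slot of `l₀` lifts to the
invariance vector `z ↑ i₀` of `in_o f`. -/
theorem insertNth_inv_of_inv_cons_zero_w {n : ℕ} (w : Fin (n + 1) → ℕ) (c : Fin (n + 1) → k) (hw : ∀ l, w l ≤ 1)
    (hc0 : ∀ l, w l = 0 → c l = 0) {l₀ : Fin (n + 1)} (hl₀ : ∀ l, w l = 0 ↔ l = l₀) (i₀ : Fin (n + 1)) (hi₀ : i₀ ≠ l₀)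
    (f : MvPowerSeries (Fin (n + 1)) k) {o : ℕ} (hperm : (o : ℕ∞) ≤ f.weightedOrder w) {G : MvPowerSeries (Fin (n + 1 + 1)) k}
    (hfac : subst (CobordantChart.chart w c) f = X 0 ^ o * G)
    {t : Fin (n + 1) → k} (hti₀ : t i₀ ≠ 0)
    (ht : ∀ v, CobordantChart.initEval (fun _ : Fin (n + 1) => 1) (v + t) o f = CobordantChart.initEval (fun _ : Fin (n + 1) => 1) v o f)
    (hpar : ∀ v, CobordantChart.initEval (fun _ : Fin (n + 1) => 1) (v + Pi.single l₀ 1) o f =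
      CobordantChart.initEval (fun _ : Fin (n + 1) => 1) v o f)
    {z : Fin n → k} (hzw : ∀ j, i₀.succAbove j = l₀ → z j = 0)
    (hz : ∀ W, CobordantChart.initEval (fun _ : Fin (n + 1) => 1) (W + Fin.cons (0 : k) z) o (TupleGame.slice i₀ G) =
      CobordantChart.initEval (fun _ : Fin (n + 1) => 1) W o (TupleGame.slice i₀ G))
    (v : Fin (n + 1) → k) :
    CobordantChart.initEval (fun _ : Fin (n + 1) => 1) (v + Fin.insertNth i₀ (0 : k) z) o f =
      CobordantChart.initEval (fun _ : Fin (n + 1) => 1) v o f := by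
  classical
  have hzw' : ∀ j, w (i₀.succAbove j) = 0 → z j = 0 := fun j hj => hzw j ((hl₀ _).mp hj)
  -- on the parameter-free slice plane: the restriction identity, twice
  have hplane : ∀ v' : Fin n → k, (∀ j, w (i₀.succAbove j) = 0 → v' j = 0) →
      CobordantChart.initEval (fun _ : Fin (n + 1) => 1) (Fin.insertNth i₀ (0 : k) v' + Fin.insertNth i₀ (0 : k) z) o f =
        CobordantChart.initEval (fun _ : Fin (n + 1) => 1) (Fin.insertNth i₀ (0 : k) v') o f := by
    intro v' hv'
    have hvz : ∀ j, w (i₀.succAbove j) = 0 → (v' + z) j = 0 := fun j hj => by rw [Pi.add_apply, hv' j hj, hzw' j hj, add_zero]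
    rw [← insertNth_zero_add, ← initEval_slice_cons_zero_w w c hw hc0 i₀ f hperm hfac (v' + z) hvz,
      ← initEval_slice_cons_zero_w w c hw hc0 i₀ f hperm hfac v' hv', cons_zero_add, hz]
  -- the reduction of a vector to the parameter-free slice plane: `u ↦ u + λ t + μ e_{l₀}`
  set lam : k := -(v i₀ / t i₀) with hlam
  set mu : k := -((v + lam • t) l₀) with hmu
  set v₂ : Fin (n + 1) → k := v + lam • t + mu • Pi.single l₀ (1 : k) with hv₂
  have hv₂i : v₂ i₀ = 0 := by
    rw [hv₂, Pi.add_apply, Pi.add_apply, Pi.smul_apply, Pi.smul_apply, Pi.single_eq_of_ne hi₀, smul_zero, add_zero, smul_eq_mul, hlam]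
    field_simp
    ring
  have hv₂l : v₂ l₀ = 0 := by
    rw [hv₂, Pi.add_apply, Pi.smul_apply, Pi.single_eq_same, smul_eq_mul, mul_one, hmu]
    ring
  have hred : ∀ u : Fin (n + 1) → k, CobordantChart.initEval (fun _ : Fin (n + 1) => 1) (u + lam • t + mu • Pi.single l₀ (1 : k)) o f =
      CobordantChart.initEval (fun _ : Fin (n + 1) => 1) u o f := fun u => by
    rw [inv_smul hpar mu, inv_smul ht lam]
  -- `v₂` lies on the parameter-free slice plane
  set v' : Fin n → k := fun j => v₂ (i₀.succAbove j) with hv'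
  have hins : Fin.insertNth i₀ (0 : k) v' = v₂ := by
    funext l
    rcases Fin.eq_self_or_eq_succAbove i₀ l with rfl | ⟨j, rfl⟩
    · rw [Fin.insertNth_apply_same, hv₂i]
    · rw [Fin.insertNth_apply_succAbove]
  have hv'w : ∀ j, w (i₀.succAbove j) = 0 → v' j = 0 := fun j hj => by
    show v₂ (i₀.succAbove j) = 0
    rw [(hl₀ _).mp hj]; exact hv₂l
  -- assemble
  have h1 : v + Fin.insertNth i₀ (0 : k) z + lam • t + mu • Pi.single l₀ (1 : k) = v₂ + Fin.insertNth i₀ (0 : k) z := by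
    rw [hv₂]; abel
  have e1 : CobordantChart.initEval (fun _ : Fin (n + 1) => 1) (v + Fin.insertNth i₀ (0 : k) z + lam • t + mu • Pi.single l₀ (1 : k)) o f =
      CobordantChart.initEval (fun _ : Fin (n + 1) => 1) (v + Fin.insertNth i₀ (0 : k) z) o f := hred _
  have e2 : CobordantChart.initEval (fun _ : Fin (n + 1) => 1) (v + lam • t + mu • Pi.single l₀ (1 : k)) o f =
      CobordantChart.initEval (fun _ : Fin (n + 1) => 1) v o f := hred v
  have h2 : v + lam • t + mu • Pi.single l₀ (1 : k) = v₂ := by rw [hv₂]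
  rw [← e1, ← e2, h1, h2, ← hins]
  exact hplane v' hv'w

/-- **`e ≤ 2` PERSISTS AT THE NEAR POINT OF A CURVE MOVE WHOSE DIRECTRIX KERNEL IS TRIVIAL** (memo §9).  One parameter letter `l₀`; `t` (live at
`i₀`) and `e_{l₀}` in `Dir(in_o f)`; marked letters `S` through which the answer passes (`c_l = 0`); KERNEL HYPOTHESIS: an invariance vector of
`in_o f` vanishing at `i₀`, at `l₀` and on `S` is zero.  Then every three invariance vectors of the successor's form `in_o G′` vanishing on the new
marked letters are dependent: their projections to the `(s, y_{l₀′})`-plane are dependent, and a combination with zero projection is `(0, z)` with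
`z` vanishing at `l₀′` and on the marks, which lifts (`insertNth_inv_of_inv_cons_zero_w`) to the kernel — hence vanishes. -/
theorem apexPlane_of_near_kernel {n : ℕ} (w : Fin (n + 1) → ℕ) (c : Fin (n + 1) → k) (hw : ∀ l, w l ≤ 1)
    (hc0 : ∀ l, w l = 0 → c l = 0) {l₀ : Fin (n + 1)} (hl₀ : ∀ l, w l = 0 ↔ l = l₀) (i₀ : Fin (n + 1)) (hi₀ : i₀ ≠ l₀)
    (f : MvPowerSeries (Fin (n + 1)) k) {o : ℕ} (hperm : (o : ℕ∞) ≤ f.weightedOrder w) {G : MvPowerSeries (Fin (n + 1 + 1)) k}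
    (hfac : subst (CobordantChart.chart w c) f = X 0 ^ o * G)
    {t : Fin (n + 1) → k} (hti₀ : t i₀ ≠ 0)
    (ht : ∀ v, CobordantChart.initEval (fun _ : Fin (n + 1) => 1) (v + t) o f = CobordantChart.initEval (fun _ : Fin (n + 1) => 1) v o f)
    (hpar : ∀ v, CobordantChart.initEval (fun _ : Fin (n + 1) => 1) (v + Pi.single l₀ 1) o f =
      CobordantChart.initEval (fun _ : Fin (n + 1) => 1) v o f)
    (S : Finset (Fin (n + 1)))
    (hker : ∀ u : Fin (n + 1) → k,
      (∀ v, CobordantChart.initEval (fun _ : Fin (n + 1) => 1) (v + u) o f = CobordantChart.initEval (fun _ : Fin (n + 1) => 1) v o f) →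
      u i₀ = 0 → u l₀ = 0 → (∀ l ∈ S, u l = 0) → u = 0)
    (w₁ w₂ w₃ : Fin (n + 1) → k)
    (hw₁ : ∀ v, CobordantChart.initEval (fun _ : Fin (n + 1) => 1) (v + w₁) o (TupleGame.slice i₀ G) =
      CobordantChart.initEval (fun _ : Fin (n + 1) => 1) v o (TupleGame.slice i₀ G))
    (hw₁S : ∀ l ∈ S, w₁ (Fin.predAbove i₀ l.succ) = 0)
    (hw₂ : ∀ v, CobordantChart.initEval (fun _ : Fin (n + 1) => 1) (v + w₂) o (TupleGame.slice i₀ G) =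
      CobordantChart.initEval (fun _ : Fin (n + 1) => 1) v o (TupleGame.slice i₀ G))
    (hw₂S : ∀ l ∈ S, w₂ (Fin.predAbove i₀ l.succ) = 0)
    (hw₃ : ∀ v, CobordantChart.initEval (fun _ : Fin (n + 1) => 1) (v + w₃) o (TupleGame.slice i₀ G) =
      CobordantChart.initEval (fun _ : Fin (n + 1) => 1) v o (TupleGame.slice i₀ G))
    (hw₃S : ∀ l ∈ S, w₃ (Fin.predAbove i₀ l.succ) = 0) :
    ∃ α β γ : k, (α ≠ 0 ∨ β ≠ 0 ∨ γ ≠ 0) ∧ α • w₁ + β • w₂ + γ • w₃ = 0 := by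
  classical
  -- the slot of the parameter letter among the new letters
  obtain ⟨q₀, hq₀⟩ := Fin.exists_succAbove_eq (Ne.symm hi₀)
  -- the projections to the `(s, y_{l₀′})`-plane are dependent
  set pr : (Fin (n + 1) → k) → (Fin 2 → k) := fun u => ![u 0, u q₀.succ] with hpr
  have hdep : ¬ LinearIndependent k (fun i : Fin 3 => pr (![w₁, w₂, w₃] i)) := by
    intro hli
    have h := hli.fintype_card_le_finrank
    simp at h
  rw [Fintype.not_linearIndependent_iff] at hdep
  obtain ⟨g, hg, i, hgi⟩ := hdep
  -- the combination with zero projection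
  set W : Fin (n + 1) → k := g 0 • w₁ + g 1 • w₂ + g 2 • w₃ with hW
  have hWpr : ∀ r : Fin 2, (g 0 * (pr w₁) r + g 1 * (pr w₂) r + g 2 * (pr w₃) r) = 0 := by
    intro r
    have h := congr_fun hg r
    rw [Fin.sum_univ_three] at h
    simpa using h
  have hW0 : W 0 = 0 := by
    have h := hWpr 0
    simp only [hpr, Matrix.cons_val_zero] at h
    simp only [hW, Pi.add_apply, Pi.smul_apply, smul_eq_mul]
    exact h
  have hWq : W q₀.succ = 0 := by
    have h := hWpr 1
    simp only [hpr, Matrix.cons_val_one, Matrix.cons_val_fin_one] at h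
    simp only [hW, Pi.add_apply, Pi.smul_apply, smul_eq_mul]
    exact h
  have hWinv : ∀ v, CobordantChart.initEval (fun _ : Fin (n + 1) => 1) (v + W) o (TupleGame.slice i₀ G) =
      CobordantChart.initEval (fun _ : Fin (n + 1) => 1) v o (TupleGame.slice i₀ G) := by
    intro v
    rw [hW, ← add_assoc v, ← add_assoc v]
    rw [inv_smul hw₃ (g 2), inv_smul hw₂ (g 1), inv_smul hw₁ (g 0)]
  have hWS : ∀ l ∈ S, W (Fin.predAbove i₀ l.succ) = 0 := fun l hl => by
    simp only [hW, Pi.add_apply, Pi.smul_apply, smul_eq_mul, hw₁S l hl, hw₂S l hl, hw₃S l hl, mul_zero, add_zero]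
  -- `W = (0, z)`
  set z : Fin n → k := Fin.tail W with hz
  have hWz : W = Fin.cons (0 : k) z := by
    rw [hz, ← hW0, Fin.cons_self_tail]
  have hzq : ∀ j, i₀.succAbove j = l₀ → z j = 0 := by
    intro j hj
    have hjq : j = q₀ := Fin.succAbove_right_injective (hj.trans hq₀.symm)
    rw [hjq, hz, Fin.tail]
    exact hWq
  have hzinv : ∀ V, CobordantChart.initEval (fun _ : Fin (n + 1) => 1) (V + Fin.cons (0 : k) z) o (TupleGame.slice i₀ G) =
      CobordantChart.initEval (fun _ : Fin (n + 1) => 1) V o (TupleGame.slice i₀ G) := by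
    intro V; rw [← hWz]; exact hWinv V
  -- lift to the kernel
  have hlift := insertNth_inv_of_inv_cons_zero_w w c hw hc0 hl₀ i₀ hi₀ f hperm hfac hti₀ ht hpar hzq hzinv
  have hins0 : (Fin.insertNth i₀ (0 : k) z : Fin (n + 1) → k) = 0 := by
    refine hker (Fin.insertNth i₀ (0 : k) z : Fin (n + 1) → k) hlift (by rw [Fin.insertNth_apply_same]) ?_ ?_
    · rw [← hq₀, Fin.insertNth_apply_succAbove]
      exact hzq q₀ hq₀
    · intro l hl
      rcases Fin.eq_self_or_eq_succAbove i₀ l with rfl | ⟨j, rfl⟩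
      · rw [Fin.insertNth_apply_same]
      · rw [Fin.insertNth_apply_succAbove, hz, Fin.tail]
        have h := hWS _ hl
        rwa [RestrictedChartTransport.predAbove_succAbove_succ] at h
  have hz0 : z = 0 := by
    funext j
    have h := congr_fun hins0 (i₀.succAbove j)
    rwa [Fin.insertNth_apply_succAbove] at h
  have hWzero : W = 0 := by
    rw [hWz, hz0]
    funext l
    refine Fin.cases ?_ (fun j => ?_) l
    · rfl
    · simp
  refine ⟨g 0, g 1, g 2, ?_, by rw [← hW]; exact hWzero⟩
  by_contra hnot
  push Not at hnot
  apply hgi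
  fin_cases i
  · exact hnot.1
  · exact hnot.2.1
  · exact hnot.2.2

end TOT2Near

end Summit.ResolutionOfSingularities.ResolutionOfSingularities.Theorems

end
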